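import Summits.NavierStokesRegularity.NavierStokesRegularity.Theorems.AxisymmetricExtremalityAxisymmetricKatoGlobalStubSeregin2020TypeIILemma22ExcisionBallCutoffErrors
import Literature.Analysis.FluidPDE.HeatGradDivCalculus
import HarnessLib

/-!
# Seregin 2020, Lemma 2.2: the gradient excision error (e1), text of record — L22-B, piece F3b.4 (e1)

Seat ns-es-p1 g3 (INPUTS A1 / L22-B; cut owner ns-inputs-plan g6 ruling 2026-08-28T09:39Z: es-p1 = (e1), ser-c = (e2)(e3); consumer
ns-in-ser-b's `pieceEnergy_expanded`, integrand `iB`).  For FIXED data `Φ ≥ 0` measurable, `H ∈ C²` with `H' ≤ 0 ≤ H`, `Θ ∈ C¹_c`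
with `tsupport Θ ⊆ B(0, 2R)`, `η ∈ C¹`, and a bump constant `C₀ ≥ 0`, there is `K ≥ 0` such that for every active set `A`, centres
`xᵢ`, radii `rᵢ > 0`, admissible bumps `ψᵢ` and every step `[a, b] ⊆ [t₁, t₂]`:
`η H(Φ) Θ² ‖∇∏_{i∈A}(1-ψᵢ)‖²` is integrable on `[a,b] × ℝ³` and
`∬_{[a,b]×ℝ³} |η H(Φ) Θ² ‖∇∏(1-ψᵢ)‖²| ≤ K (b - a) ∑_{i,j∈A} min(rᵢ,rⱼ)³/(rᵢrⱼ)`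
(`excisionError_gradSq` with the weight `W = 1_{[a,b]}(t) η(t) H(Φ(t,y)) Θ(y)²`, `|W| ≤ ‖η‖_{∞,[t₁,t₂]} H(0) ‖Θ‖²_∞`; the
support hypothesis on `Θ` is idle here and kept only so that (e1)(e2)(e3) share one list of fixed data).

WHAT THIS IS NOT: nothing about Navier–Stokes; no summit statement is proved here. [NazarovUraltseva2012 §3 (3.9); Seregin2020 §3]
-/

-- the problem directory repeats the summit name (D-0017); core's `dupNamespace` linter fires
set_option linter.dupNamespace false

noncomputable section

open MeasureTheory Set Function Filter Topology TopologicalSpace Metric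
open scoped NNReal ENNReal

namespace Summit.NavierStokesRegularity.NavierStokesRegularity.Theorems.AxisymmetricKatoGlobal.EulerScaling

open Literature.Analysis.FluidPDE

/-- **(e1), text of record: the gradient excision error.** See the module docstring. [cite: NazarovUraltseva2012, §3 (3.9)] -/
theorem excision_gradError_le
    {Φ : ℝ → EuclideanSpace ℝ (Fin 3) → ℝ} {H : ℝ → ℝ} {Θ : EuclideanSpace ℝ (Fin 3) → ℝ} {η : ℝ → ℝ}
    {R t₁ t₂ C₀ : ℝ}
    (hΦm : Measurable (uncurry Φ)) (hΦ0 : ∀ t x, 0 ≤ Φ t x)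
    (hH : ContDiff ℝ 2 H) (hH' : ∀ v, deriv H v ≤ 0) (hH0 : ∀ v, 0 ≤ H v)
    (hΘ : ContDiff ℝ 1 Θ) (hΘc : HasCompactSupport Θ)
    (_hΘs : tsupport Θ ⊆ ball (0 : EuclideanSpace ℝ (Fin 3)) (2 * R))
    (hη : ContDiff ℝ 1 η) (hC₀ : 0 ≤ C₀) :
    ∃ K : ℝ, 0 ≤ K ∧ ∀ (A : Finset ℕ) (x : ℕ → EuclideanSpace ℝ (Fin 3)) (r : ℕ → ℝ)
      (ψ : ℕ → EuclideanSpace ℝ (Fin 3) → ℝ) (a b : ℝ), t₁ ≤ a → a ≤ b → b ≤ t₂ →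
      (∀ i ∈ A, 0 < r i) → (∀ i ∈ A, ContDiff ℝ 1 (ψ i)) → (∀ i ∈ A, ∀ y, 0 ≤ ψ i y ∧ ψ i y ≤ 1) →
      (∀ i ∈ A, ∀ y, ‖fderiv ℝ (ψ i) y‖ ≤ C₀ / r i) →
      (∀ i ∈ A, ∀ y, y ∉ ball (x i) (4 * r i) → fderiv ℝ (ψ i) y = 0) →
      IntegrableOn (fun z : ℝ × EuclideanSpace ℝ (Fin 3) => η z.1 * (H (Φ z.1 z.2) *
          (Θ z.2 ^ 2 * ‖gradient (fun y => ∏ i ∈ A, (1 - ψ i y)) z.2‖ ^ 2)))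
        (Icc a b ×ˢ univ) volume ∧
      ∫ z in Icc a b ×ˢ (univ : Set (EuclideanSpace ℝ (Fin 3))), |η z.1 * (H (Φ z.1 z.2) *
          (Θ z.2 ^ 2 * ‖gradient (fun y => ∏ i ∈ A, (1 - ψ i y)) z.2‖ ^ 2))|
        ≤ K * (b - a) * ∑ i ∈ A, ∑ j ∈ A, min (r i) (r j) ^ 3 / (r i * r j) := by
  -- ### the constants of the fixed data
  obtain ⟨Cη, hCη⟩ := isCompact_Icc.exists_bound_of_continuousOn (hη.continuous.continuousOn (s := Icc t₁ t₂))
  obtain ⟨CΘ, hCΘ⟩ := hΘ.continuous.bounded_above_of_compact_support hΘc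
  have hCη0 : 0 ≤ Cη ∨ Icc t₁ t₂ = ∅ := by
    rcases (Icc t₁ t₂).eq_empty_or_nonempty with h | ⟨s, hs⟩
    · exact Or.inr h
    · exact Or.inl ((norm_nonneg _).trans (hCη s hs))
  have hCΘ0 : 0 ≤ CΘ := (norm_nonneg _).trans (hCΘ 0)
  have hHanti : Antitone H := antitone_of_deriv_nonpos (hH.differentiable (by norm_num)) hH'
  have hHΦ : ∀ t y, H (Φ t y) ≤ H 0 := fun t y => hHanti (hΦ0 t y)
  set CW : ℝ := |Cη| * (H 0 * CΘ ^ 2) with hCW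
  have hCW0 : 0 ≤ CW := by have := hH0 0; positivity
  refine ⟨CW * (64 * (Real.pi * 4 / 3) * C₀ ^ 2), by positivity, ?_⟩
  intro A x r ψ a b h1a hab hb2 hr hψ h01 hgrad hgrad0
  have h0 : ∀ i ∈ A, ∀ y, 0 ≤ ψ i y := fun i hi y => (h01 i hi y).1
  have h1 : ∀ i ∈ A, ∀ y, ψ i y ≤ 1 := fun i hi y => (h01 i hi y).2
  -- ### the weight `W = 1_{[a,b]} η · H(Φ) · Θ²`
  set W : ℝ × EuclideanSpace ℝ (Fin 3) → ℝ := fun z =>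
    (Icc a b).indicator η z.1 * (H (Φ z.1 z.2) * Θ z.2 ^ 2) with hW
  have hWm : AEStronglyMeasurable W (volume.restrict (Icc a b ×ˢ (univ : Set (EuclideanSpace ℝ (Fin 3))))) := by
    refine Measurable.aestronglyMeasurable ?_
    refine ((hη.continuous.measurable.indicator measurableSet_Icc).comp measurable_fst).mul
      ((hH.continuous.measurable.comp hΦm).mul ((hΘ.continuous.pow 2).measurable.comp measurable_snd))
  have hWb : ∀ z, |W z| ≤ CW := by
    intro z
    rw [hW]; simp only
    rw [abs_mul, abs_mul, hCW]
    have hηb : |(Icc a b).indicator η z.1| ≤ |Cη| := by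
      by_cases hz : z.1 ∈ Icc a b
      · rw [indicator_of_mem hz]
        exact ((Real.norm_eq_abs _).symm.le.trans (hCη z.1 ⟨h1a.trans hz.1, hz.2.trans hb2⟩)).trans (le_abs_self _)
      · rw [indicator_of_notMem hz, abs_zero]; exact abs_nonneg _
    have hHb : |H (Φ z.1 z.2)| ≤ H 0 := by rw [abs_of_nonneg (hH0 _)]; exact hHΦ _ _
    have hΘb : |Θ z.2 ^ 2| ≤ CΘ ^ 2 := by
      rw [abs_pow]; exact pow_le_pow_left₀ (abs_nonneg _) ((Real.norm_eq_abs _).symm.le.trans (hCΘ z.2)) 2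
    exact mul_le_mul hηb (mul_le_mul hHb hΘb (abs_nonneg _) (hH0 0)) (by positivity) (abs_nonneg _)
  obtain ⟨hI, hb⟩ := excisionError_gradSq hr hC₀ hψ h0 h1 hgrad hgrad0 hab hWm hWb
  -- ### back to the stated integrand
  have hset : MeasurableSet (Icc a b ×ˢ (univ : Set (EuclideanSpace ℝ (Fin 3)))) := measurableSet_Icc.prod MeasurableSet.univ
  have heq : ∀ z ∈ Icc a b ×ˢ (univ : Set (EuclideanSpace ℝ (Fin 3))),
      W z * ‖fderiv ℝ (fun y => ∏ i ∈ A, (1 - ψ i y)) z.2‖ ^ 2 =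
        η z.1 * (H (Φ z.1 z.2) * (Θ z.2 ^ 2 * ‖gradient (fun y => ∏ i ∈ A, (1 - ψ i y)) z.2‖ ^ 2)) := by
    intro z hz
    rw [hW]; simp only
    rw [indicator_of_mem hz.1, norm_gradient_eq_norm_fderiv']; ring
  refine ⟨hI.congr (ae_restrict_of_forall_mem hset fun z hz => heq z hz), ?_⟩
  have habs : ∀ z ∈ Icc a b ×ˢ (univ : Set (EuclideanSpace ℝ (Fin 3))),
      |η z.1 * (H (Φ z.1 z.2) * (Θ z.2 ^ 2 * ‖gradient (fun y => ∏ i ∈ A, (1 - ψ i y)) z.2‖ ^ 2))| =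
        |W z| * ‖fderiv ℝ (fun y => ∏ i ∈ A, (1 - ψ i y)) z.2‖ ^ 2 := by
    intro z hz
    rw [← heq z hz, abs_mul, abs_of_nonneg (sq_nonneg ‖fderiv ℝ (fun y => ∏ i ∈ A, (1 - ψ i y)) z.2‖)]
  rw [setIntegral_congr_fun hset habs]
  refine hb.trans (le_of_eq ?_)
  ring

end Summit.NavierStokesRegularity.NavierStokesRegularity.Theorems.AxisymmetricKatoGlobal.EulerScaling

end
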